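import Summits.CriticalPhenomena.PercolationContinuityZ3.Theorems.PercNearOneGluingNoHeavyLowerTailKnQuestion8CoefficientwiseCoreClassKernelMixShortThreadPrep
import HarnessLib

/-!
# Thread slicing: set-level cluster lemmas and the parallel-edge identity (A3)

Support file (`--supports stmt-CriticalPhenomena-4575`, closed), prover `prim-cplus-coupling` (gen 53).  No definitions, no notations, no named facts,
no sorries; standard axioms.  Memo `prim-cplus-coupling/A5-COUPLING-gen53.md` §1.3 (A3), §1.5.

* `cluster_path_two_eq_insert`: for a set `S` of pairs avoiding a vertex `x ∉ {u, b}`, `C_u(S + ux + xb) = C_u(S + ub) ∪ {x}` (a pendant path of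
  length two through a fresh vertex versus a direct edge);
* `iet_split_parallelEdge`: for an arbitrary multigraph, two parallel `u–b` edge indices `f ≠ f′` outside `E′`: the IET sum over the colourings of
  `E′ + f + f′` equals the IET sum over `E′ + f` for the event `ω ↦ 𝒱(ω + f′ if f ∈ ω)` — the mixed slices have `b` red- and blue-joined to `u` and vanish.
[cite: KozmaNitzan2024, Questions 8–9 (§5.5 p. 36) (context)]
-/

namespace Summit.CriticalPhenomena.PercolationContinuityZ3.Theorems

open Finset Literature.Probability.Percolation

namespace Coefficientwise

variable {ι V : Type*}

/-- Closed-set principle for a configuration given as a set of unordered pairs. [folklore] -/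
theorem openCluster_subset_of_pairClosed {ω : Set (Sym2 V)} {a : V} {U : Set V} (ha : a ∈ U)
    (hU : ∀ y ∈ U, ∀ z, s(y, z) ∈ ω → y ≠ z → z ∈ U) : openCluster ω a ⊆ U := by
  intro v hv
  change (openGraph ω).Reachable a v at hv
  rw [SimpleGraph.reachable_iff_reflTransGen] at hv
  induction hv with
  | refl => exact ha
  | @tail y z _ hyz ih =>
    rw [openGraph_adj] at hyz
    exact hU y ih z hyz.1 hyz.2

/-- One step along an edge of the configuration. [folklore] -/
theorem mem_openCluster_of_mem_pair {ω : Set (Sym2 V)} {a y z : V} (hyz : s(y, z) ∈ ω) (hy : y ∈ openCluster ω a) :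
    z ∈ openCluster ω a := by
  by_cases h : y = z
  · subst h; exact hy
  · exact SimpleGraph.Reachable.trans hy (SimpleGraph.Adj.reachable ((openGraph_adj ω y z).2 ⟨hyz, h⟩))

/-- **Pendant path versus pendant edge.**  For a set `S` of pairs avoiding `x` (`x ≠ u, b`, `u ≠ b`):
`C_u(S + ux + xb) = C_u(S + ub) ∪ {x}`. [folklore] -/
theorem cluster_path_two_eq_insert (S : Set (Sym2 V)) (u b x : V) (hxu : x ≠ u) (hxb : x ≠ b) (hub : u ≠ b)
    (hx : ∀ z ∈ S, x ∉ z) :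
    openCluster (insert s(u, x) (insert s(x, b) S)) u = insert x (openCluster (insert s(u, b) S) u) := by
  apply Set.Subset.antisymm
  · refine openCluster_subset_of_pairClosed (Set.mem_insert_of_mem _ (mem_openCluster_self _ _)) ?_
    intro y hy z hyz hne
    rcases hyz with h1 | h1 | h1
    · -- the pair {u, x}
      rcases Sym2.eq_iff.mp h1 with ⟨rfl, rfl⟩ | ⟨rfl, rfl⟩
      · exact Set.mem_insert _ _
      · exact Set.mem_insert_of_mem _ (mem_openCluster_self _ _)
    · rcases Sym2.eq_iff.mp h1 with ⟨rfl, rfl⟩ | ⟨rfl, rfl⟩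
      · exact Set.mem_insert_of_mem _ (mem_openCluster_of_mem_pair (Set.mem_insert _ _) (mem_openCluster_self _ _))
      · exact Set.mem_insert _ _
    · rcases hy with rfl | hy
      · exact absurd (Sym2.mem_mk_left _ _) (hx _ h1)
      · exact Set.mem_insert_of_mem _ (mem_openCluster_of_mem_pair (Set.mem_insert_of_mem _ h1) hy)
  · intro y hy
    rcases hy with rfl | hy
    · exact mem_openCluster_of_mem_pair (Set.mem_insert _ _) (mem_openCluster_self _ _)
    · revert hy
      refine fun hy => openCluster_subset_of_pairClosed (U := openCluster (insert s(u, x) (insert s(x, b) S)) u)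
        (mem_openCluster_self _ _) ?_ hy
      intro y' hy' z hyz hne
      rcases hyz with h1 | h1
      · rcases Sym2.eq_iff.mp h1 with ⟨rfl, rfl⟩ | ⟨rfl, rfl⟩
        · exact mem_openCluster_of_mem_pair (Set.mem_insert_of_mem _ (Set.mem_insert _ _))
            (mem_openCluster_of_mem_pair (Set.mem_insert _ _) (mem_openCluster_self _ _))
        · exact mem_openCluster_self _ _
      · exact mem_openCluster_of_mem_pair (Set.mem_insert_of_mem _ (Set.mem_insert_of_mem _ h1)) hy'

/-- Image of `insert`. [folklore] -/
theorem ends_image_coe_insert [DecidableEq ι] (ends : ι → Sym2 V) (i : ι) (η : Finset ι) :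
    ends '' (↑(insert i η) : Set ι) = insert (ends i) (ends '' (↑η : Set ι)) := by
  rw [Finset.coe_insert, Set.image_insert_eq]

/-- Two index maps that agree on `η` give the same configuration. [folklore] -/
theorem ends_image_coe_congr (ends ends' : ι → Sym2 V) (η : Finset ι) (h : ∀ i ∈ η, ends' i = ends i) :
    ends' '' (↑η : Set ι) = ends '' (↑η : Set ι) := by
  apply Set.image_congr
  intro i hi
  exact h i (Finset.mem_coe.mp hi)

open Classical in
/-- **Parallel `u–b` edges.**  If `f ≠ f′ ∉ E′` carry the same pair (`ends f = ends f′`, a pair containing... any pair joining `u` to `b`: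
`ends f = s(u,b)`), the IET sum over `E′ + f + f′` equals the IET sum over `E′ + f` for the event `ω ↦ 𝒱(ω + f′ if f ∈ ω else ω)`:
the mixed slices have `b` both red- and blue-joined to `u` and contribute nothing. [cite: KozmaNitzan2024, Questions 8–9 (§5.5 p. 36) (context)] -/
theorem iet_split_parallelEdge (ends : ι → Sym2 V) (E' : Finset ι) (f f' : ι) (u b : V)
    (hff : f ≠ f') (hfE' : f ∉ E') (hf'E' : f' ∉ E') (hf : ends f = s(u, b)) (hf' : ends f' = s(u, b))
    (𝒱 : Finset ι → Prop) (h k ha hb ka kb : Set V → ℝ) :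
    ((∑ ω ∈ (insert f (insert f' E')).powerset, if 𝒱 ω ∧ b ∈ openCluster (ends '' (↑ω : Set ι)) u ∧
          b ∉ openCluster (ends '' (↑((insert f (insert f' E')) \ ω) : Set ι)) u then
        h (openCluster (ends '' (↑ω : Set ι)) u) * k (openCluster (ends '' (↑ω : Set ι)) u) else 0)
      + ∑ ω ∈ (insert f (insert f' E')).powerset, if 𝒱 ω ∧ b ∈ openCluster (ends '' (↑((insert f (insert f' E')) \ ω) : Set ι)) u ∧
          b ∉ openCluster (ends '' (↑ω : Set ι)) u then
        (ha (openCluster (ends '' (↑ω : Set ι)) u) - hb (openCluster (ends '' (↑((insert f (insert f' E')) \ ω) : Set ι)) u)) *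
          (ka (openCluster (ends '' (↑ω : Set ι)) u) - kb (openCluster (ends '' (↑((insert f (insert f' E')) \ ω) : Set ι)) u)) else 0)
    = (∑ ω ∈ (insert f E').powerset, if 𝒱 (if f ∈ ω then insert f' ω else ω) ∧ b ∈ openCluster (ends '' (↑ω : Set ι)) u ∧
          b ∉ openCluster (ends '' (↑((insert f E') \ ω) : Set ι)) u then
        h (openCluster (ends '' (↑ω : Set ι)) u) * k (openCluster (ends '' (↑ω : Set ι)) u) else 0)
      + ∑ ω ∈ (insert f E').powerset, if 𝒱 (if f ∈ ω then insert f' ω else ω) ∧ b ∈ openCluster (ends '' (↑((insert f E') \ ω) : Set ι)) u ∧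
          b ∉ openCluster (ends '' (↑ω : Set ι)) u then
        (ha (openCluster (ends '' (↑ω : Set ι)) u) - hb (openCluster (ends '' (↑((insert f E') \ ω) : Set ι)) u)) *
          (ka (openCluster (ends '' (↑ω : Set ι)) u) - kb (openCluster (ends '' (↑((insert f E') \ ω) : Set ι)) u)) else 0 := by
  set E : Finset ι := insert f (insert f' E') with hE
  set C : Finset ι → Set V := fun ω => openCluster (ends '' (↑ω : Set ι)) u with hC
  have hffE' : f ∉ insert f' E' := by
    rw [Finset.mem_insert]; rintro (h' | h'); exact hff h'; exact hfE' h'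
  have sdiff_f : ∀ η, η ⊆ E' → E \ insert f η = insert f' (E' \ η) := sdiff_insert_insert_f E E' f f' hE hff hfE' hf'E'
  have sdiff_g : ∀ η, η ⊆ E' → E \ insert f' η = insert f (E' \ η) := sdiff_insert_insert_g E E' f f' hE hff hfE' hf'E'
  have sdiff_0 : ∀ η, η ⊆ E' → E \ η = insert f (insert f' (E' \ η)) := sdiff_insert_insert_none E E' f f' hE hfE' hf'E'
  have sdiff_fg : ∀ η : Finset ι, E \ insert f (insert f' η) = E' \ η := sdiff_insert_insert_both E E' f f' hE hfE' hf'E'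
  have hfdiff : ∀ η, η ⊆ E' → insert f E' \ insert f η = E' \ η := by
    intro η hη
    ext i
    simp only [Finset.mem_sdiff, Finset.mem_insert]
    constructor
    · rintro ⟨h1, h2⟩
      push Not at h2
      rcases h1 with rfl | h1
      · exact absurd rfl h2.1
      · exact ⟨h1, h2.2⟩
    · rintro ⟨h1, h2⟩
      refine ⟨Or.inr h1, ?_⟩
      push Not; exact ⟨fun h' => hfE' (h' ▸ h1), h2⟩
  have hfdiff0 : ∀ η, η ⊆ E' → insert f E' \ η = insert f (E' \ η) := by
    intro η hη
    ext i
    simp only [Finset.mem_sdiff, Finset.mem_insert]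
    constructor
    · rintro ⟨h1, h2⟩
      rcases h1 with rfl | h1
      · exact Or.inl rfl
      · exact Or.inr ⟨h1, h2⟩
    · rintro (rfl | ⟨h1, h2⟩)
      · exact ⟨Or.inl rfl, fun h' => hfE' (hη h')⟩
      · exact ⟨Or.inr h1, h2⟩
  -- the two parallel edges give the same configuration as one of them
  have Cff : ∀ η : Finset ι, C (insert f (insert f' η)) = C (insert f η) := by
    intro η
    simp only [hC]
    rw [ends_image_coe_insert, ends_image_coe_insert, ends_image_coe_insert, hf, hf', Set.insert_eq_of_mem (Set.mem_insert _ _)]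
  have Cf'f : ∀ η : Finset ι, C (insert f' η) = C (insert f η) := by
    intro η
    simp only [hC]
    rw [ends_image_coe_insert, ends_image_coe_insert, hf, hf']
  have hb_red : ∀ η : Finset ι, b ∈ C (insert f η) := by
    intro η
    simp only [hC]
    rw [ends_image_coe_insert, hf]
    exact mem_openCluster_of_mem_pair (Set.mem_insert _ _) (mem_openCluster_self _ _)
  set FR : Finset ι → ℝ := fun ω => if 𝒱 ω ∧ b ∈ C ω ∧ b ∉ C (E \ ω) then h (C ω) * k (C ω) else 0 with hFR
  set FD : Finset ι → ℝ := fun ω => if 𝒱 ω ∧ b ∈ C (E \ ω) ∧ b ∉ C ω then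
      (ha (C ω) - hb (C (E \ ω))) * (ka (C ω) - kb (C (E \ ω))) else 0 with hFD
  set GR : Finset ι → ℝ := fun ω => if 𝒱 (if f ∈ ω then insert f' ω else ω) ∧ b ∈ C ω ∧ b ∉ C (insert f E' \ ω) then
      h (C ω) * k (C ω) else 0 with hGR
  set GD : Finset ι → ℝ := fun ω => if 𝒱 (if f ∈ ω then insert f' ω else ω) ∧ b ∈ C (insert f E' \ ω) ∧ b ∉ C ω then
      (ha (C ω) - hb (C (insert f E' \ ω))) * (ka (C ω) - kb (C (insert f E' \ ω))) else 0 with hGD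
  change (∑ ω ∈ E.powerset, FR ω) + ∑ ω ∈ E.powerset, FD ω = (∑ ω ∈ (insert f E').powerset, GR ω) + ∑ ω ∈ (insert f E').powerset, GD ω
  have split : ∀ F : Finset ι → ℝ, ∑ ω ∈ E.powerset, F ω =
      (∑ η ∈ E'.powerset, F η) + (∑ η ∈ E'.powerset, F (insert f' η)) +
        ((∑ η ∈ E'.powerset, F (insert f η)) + ∑ η ∈ E'.powerset, F (insert f (insert f' η))) := by
    intro F
    rw [hE, Finset.sum_powerset_insert hffE', Finset.sum_powerset_insert hf'E', Finset.sum_powerset_insert hf'E']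
  have split' : ∀ F : Finset ι → ℝ, ∑ ω ∈ (insert f E').powerset, F ω =
      (∑ η ∈ E'.powerset, F η) + ∑ η ∈ E'.powerset, F (insert f η) := fun F => Finset.sum_powerset_insert hfE' F
  rw [split FR, split FD, split' GR, split' GD]
  -- mixed slices vanish: b is red-joined AND blue-joined to u
  have zRg : ∀ η ∈ E'.powerset, FR (insert f' η) = 0 := by
    intro η hη; rw [Finset.mem_powerset] at hη
    simp only [hFR]; rw [if_neg]; rintro ⟨_, _, hn⟩
    exact hn (by rw [sdiff_g η hη]; exact hb_red _)
  have zDg : ∀ η ∈ E'.powerset, FD (insert f' η) = 0 := by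
    intro η hη; rw [Finset.mem_powerset] at hη
    simp only [hFD]; rw [if_neg]; rintro ⟨_, _, hn⟩
    exact hn (by rw [Cf'f η]; exact hb_red _)
  have zRf : ∀ η ∈ E'.powerset, FR (insert f η) = 0 := by
    intro η hη; rw [Finset.mem_powerset] at hη
    simp only [hFR]; rw [if_neg]; rintro ⟨_, _, hn⟩
    exact hn (by rw [sdiff_f η hη, Cf'f]; exact hb_red _)
  have zDf : ∀ η ∈ E'.powerset, FD (insert f η) = 0 := by
    intro η hη; rw [Finset.mem_powerset] at hη
    simp only [hFD]; rw [if_neg]; rintro ⟨_, _, hn⟩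
    exact hn (hb_red _)
  -- boundary slices match
  have eR0 : ∀ η ∈ E'.powerset, FR η = GR η := by
    intro η hη; rw [Finset.mem_powerset] at hη
    have hfη : f ∉ η := fun h' => hfE' (hη h')
    simp only [hFR, hGR, if_neg hfη]
    apply ite_zero_congr _ (fun _ => rfl)
    rw [sdiff_0 η hη, Cff, hfdiff0 η hη]
  have eD0 : ∀ η ∈ E'.powerset, FD η = GD η := by
    intro η hη; rw [Finset.mem_powerset] at hη
    have hfη : f ∉ η := fun h' => hfE' (hη h')
    simp only [hFD, hGD, if_neg hfη]
    apply ite_zero_congr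
    · rw [sdiff_0 η hη, Cff, hfdiff0 η hη]
    · intro _; rw [sdiff_0 η hη, Cff, hfdiff0 η hη]
  have eR2 : ∀ η ∈ E'.powerset, FR (insert f (insert f' η)) = GR (insert f η) := by
    intro η hη; rw [Finset.mem_powerset] at hη
    simp only [hFR, hGR, if_pos (Finset.mem_insert_self f η)]
    apply ite_zero_congr
    · rw [sdiff_fg η, Cff η, hfdiff η hη, Finset.insert_comm]
    · intro _; rw [Cff η]
  have eD2 : ∀ η ∈ E'.powerset, FD (insert f (insert f' η)) = GD (insert f η) := by
    intro η hη; rw [Finset.mem_powerset] at hη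
    simp only [hFD, hGD, if_pos (Finset.mem_insert_self f η)]
    apply ite_zero_congr
    · rw [sdiff_fg η, Cff η, hfdiff η hη, Finset.insert_comm]
    · intro _; rw [sdiff_fg η, Cff η, hfdiff η hη]
  rw [Finset.sum_congr rfl zRg, Finset.sum_congr rfl zDg, Finset.sum_congr rfl zRf, Finset.sum_congr rfl zDf,
    Finset.sum_congr rfl eR0, Finset.sum_congr rfl eD0, Finset.sum_congr rfl eR2, Finset.sum_congr rfl eD2]
  simp only [Finset.sum_const_zero]
  ring

end Coefficientwise

end Summit.CriticalPhenomena.PercolationContinuityZ3.Theorems
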